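import Summits.BirchSwinnertonDyer.BirchSwinnertonDyer.Theorems.KatoDescentPotSupersingularMuCoreIrrConjAThree
import Summits.BirchSwinnertonDyer.BirchSwinnertonDyer.Theorems.SmallImageMuTransferMuTransferX9StepOneSahOdd
import Literature.NumberTheory.EllipticCurves.Kato2004.Condition1252
import HarnessLib

/-!
# Coates–Sujatha's statement (A) at every ODD prime `p` for `E/ℚ` with `E[p]` irreducible and `p`-adic tower NOT
# onto, from ONE `p`-indivisible genuine Λ-adic Euler-system class — the uniform odd-prime form of part I
# (routes `KatoDescentPotSupersingular` / `KatoDescentTamePotSupersingular`, Conj-A residues 19942 / 19916; route-free)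

Seat `bsd-potss-k9-c4` g14 (prover; cell `bsd-potss`); `--supports stmt-BirchSwinnertonDyer-19197 --as helper`;
closes nothing.  HONEST FRAMING: BSD is not proved by any of this; Conjecture A is NOT proved — it is REDUCED to the
displayed hypothesis «some genuine Λ-adic Euler-system class in `𝐇¹_Γ(T_pW)` lies outside `p·𝐇¹_Γ`», not supplied;
nothing is booked; THEOREMS ONLY.

WHAT.  `exists_fineSelmerDualData_moduleFinite_of_irr_of_not_towerSurj_of_eulerClass`: for `W/ℚ` globally minimal,
`p ≠ 2`, `E[p]` irreducible and `ρ_{E,p^∞}` NOT onto (`¬ ∀ n, ρ̄_{E,pⁿ}` onto — the binder of the Conj-A residue items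
19942 / 19916), every cyclotomic `κ`: the displayed class hypothesis gives `∃ γ D, Module.Finite ℤ_[p] D.X`
(statement (A) at `(W, p)` in the items' currency).  Two cases, both kernel: `p ≥ 5` — tower not onto ⟹ `ρ̄_{E,p}`
not onto (Serre IV-23, tree `Kato2004.imageContainsSL2_of_hasSurjectiveModNGaloisRep`), whence the image facts
(SC) (K6's odd-prime scalar `LevelE.exists_galoisRepTorsion_eq_smul_of_ne_two`) and (IF) (`p ∤ #Ḡ`, K6) and part I's
`moduleFinite_padicInt_fineSelmerDual_of_eulerClass_of_imageFacts`; `p = 3` — part I's `…_three_of_irr` (the μ-core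
under `E[3]` irreducible ALONE; ρ̄₃ may be onto).

References: [CoatesSujatha2005] Conjecture A; [Serre1972] §2.4–2.6; [SerreAbelianLadic1968] IV-23 Lemma 3;
[Kato2004Asterisque] §12.2, §13.8; [Washington1997] §13.2.
-/

-- the summit and its single problem are both named `BirchSwinnertonDyer` (registry layout D-0017)
set_option linter.dupNamespace false
set_option autoImplicit false

noncomputable section

open scoped NumberField
open Field IsDedekindDomain WeierstrassCurve
open Literature.NumberTheory.GaloisRepresentations Literature.NumberTheory.EllipticCurves
open Literature.NumberTheory.EllipticCurves.Kato2004 Literature.NumberTheory.EllipticCurves.Kato2004.EulerSystemValues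
open Literature.NumberTheory.EllipticCurves.IwasawaAlgebra Literature.NumberTheory.EllipticCurves.IwasawaDual

namespace Summit.BirchSwinnertonDyer.BirchSwinnertonDyer.Theorems.MuCoreIrr

/-- **(IF) from `p ∤ #ρ̄_{E,p}(Γ_ℚ)`** (the K6 source of (F2)/(F8), for the record): a normal subgroup of `Γ_ℚ`
above `ker ρ̄_{E,p}` of index `p` would force `p ∣ [Γ_ℚ : ker ρ̄] = #Ḡ`. [cite: Serre1972, §2.4 Prop. 15] -/
theorem imageFactIF_of_irr_of_not_surj (W : WeierstrassCurve ℚ) [W.IsElliptic] (p : ℕ) [Fact p.Prime]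
    (hirr : W.HasIrreducibleModPGaloisRep p) (hns : ¬ W.HasSurjectiveModNGaloisRep p) :
    ∀ N : Subgroup (absoluteGaloisGroup ℚ), N.Normal →
      (WeierstrassCurve.galoisRepTorsion W (p : ℕ)).ker ≤ N → N.index ≠ p := by
  intro N _ hle h
  have hG := Rank1Residual.not_dvd_card_range_galoisRepTorsion_of_irreducible_of_not_surjective W p hirr hns
  have hdvd : N.index ∣ (galoisRepTorsion W (p : ℕ)).ker.index := Subgroup.index_dvd_of_le hle
  rw [h, Subgroup.index_ker] at hdvd
  exact hG hdvd

/-- **(SC) from `ρ̄_{E,p}` not onto at an odd prime** (K6's odd-prime scalar, re-spelled with `•`).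
[cite: Serre1972, §2.4 Prop. 15 and §2.6] -/
theorem imageFactSC_of_irr_of_not_surj (W : WeierstrassCurve ℚ) [W.IsElliptic] (p : ℕ) [Fact p.Prime]
    (hp2 : p ≠ 2) (hirr : W.HasIrreducibleModPGaloisRep p) (hns : ¬ W.HasSurjectiveModNGaloisRep p) :
    ∃ (z : absoluteGaloisGroup ℚ) (a : ZMod p), a ≠ 1 ∧
      ∀ P : WeierstrassCurve.geomTorsion W (p : ℤ), z • P = a.val • P := by
  obtain ⟨z, a, ha, hz⟩ := Rank1Residual.LevelE.exists_galoisRepTorsion_eq_smul_of_ne_two W p hp2 hirr hns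
  exact ⟨z, a, ha, fun P => by rw [← galoisRepTorsion_apply]; exact hz P⟩

/-- **Statement (A) at `(W, p)` for every odd `p`, `E[p]` irreducible, `p`-adic tower NOT onto, from a `p`-indivisible
genuine Euler-system class** (`∃ γ D` currency of the Conj-A residue items 19942 / 19916): `p ≥ 5` through the image
facts of a non-surjective `ρ̄_{E,p}` (Serre IV-23), `p = 3` through the μ-core under `E[3]` irreducible alone (part I).
[cite: CoatesSujatha2005, §3 and Conjecture A] [cite: SerreAbelianLadic1968, Ch. IV §3.4 Lemma 3 (IV-23)]
[cite: Serre1972, §2.4 Prop. 15, §2.5–2.6] [cite: Kato2004Asterisque, §13.8 (pp. 228–229)] -/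
theorem exists_fineSelmerDualData_moduleFinite_of_irr_of_not_towerSurj_of_eulerClass
    (W : WeierstrassCurve ℚ) [W.IsElliptic] [W.IsGloballyMinimal] (p : ℕ) [Fact p.Prime] (hp2 : p ≠ 2)
    (hirr : W.HasIrreducibleModPGaloisRep p) (hnt : ¬ ∀ n : ℕ, W.HasSurjectiveModNGaloisRep (p ^ n : ℕ))
    (κ : ZpExtension ℚ p) (hκ : κ.IsCyclotomic)
    (hZ : letI : ContinuousSMul ℤ_[p] (W.tateModule p) := TateModule.continuousSMul_padicInt
      haveI : Module.Free ℤ_[p] (W.tateModule p) := W.module_free_tateModule_holds p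
      haveI : Module.Finite ℤ_[p] (W.tateModule p) := W.module_finite_tateModule_holds p
      ∀ (γ : absoluteGaloisGroup ℚ) (I : IwasawaH1Data W p κ γ), κ.IsTopGenerator γ →
        ∃ s : I.H, IsEulerSystemClass W p κ γ I s ∧
          s ∉ IwasawaAlgebra.augIdealP p • (⊤ : Submodule (IwasawaAlgebra p) I.H)) :
    ∃ (γ : absoluteGaloisGroup ℚ) (D : W.FineSelmerDualData κ γ),
      Module.Finite ℤ_[p] (RestrictScalars ℤ_[p] (IwasawaAlgebra p) D.X) := by
  by_cases h5 : 5 ≤ p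
  · letI : ContinuousSMul ℤ_[p] (W.tateModule p) := TateModule.continuousSMul_padicInt
    haveI : Module.Free ℤ_[p] (W.tateModule p) := W.module_free_tateModule_holds p
    haveI : Module.Finite ℤ_[p] (W.tateModule p) := W.module_finite_tateModule_holds p
    have hns : ¬ W.HasSurjectiveModNGaloisRep p := fun h =>
      hnt ((imageContainsSL2_iff_forall_hasSurjectiveModNGaloisRep W p).mp
        (imageContainsSL2_of_hasSurjectiveModNGaloisRep W p h5 h))
    obtain ⟨γ, hγ⟩ : ∃ γ : absoluteGaloisGroup ℚ, κ.IsTopGenerator γ := κ.surjective (Multiplicative.ofAdd 1)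
    obtain ⟨I⟩ := nonempty_iwasawaH1Data_holds W p κ γ hκ hγ
    obtain ⟨D⟩ := W.nonempty_fineSelmerDualData κ hγ
    exact ⟨γ, D, moduleFinite_padicInt_fineSelmerDual_of_eulerClass_of_imageFacts W p hp2 hκ hγ hirr
      (imageFactSC_of_irr_of_not_surj W p hp2 hirr hns) (imageFactIF_of_irr_of_not_surj W p hirr hns) I D
      (hZ γ I hγ)⟩
  · have hp : p.Prime := Fact.out
    have hp3 : p = 3 := by
      have h2 := hp.two_le
      interval_cases p
      · exact absurd rfl hp2
      · rfl
      · exact absurd hp (by decide)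
    subst hp3
    exact exists_fineSelmerDualData_moduleFinite_three_of_irr_of_eulerClass W hirr κ hκ hZ

end Summit.BirchSwinnertonDyer.BirchSwinnertonDyer.Theorems.MuCoreIrr
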